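import Summits.RiemannHypothesis.RiemannHypothesis.Theorems.Splittings.ScrewSparseDetect
import Summits.RiemannHypothesis.RiemannHypothesis.Theorems.Splittings.ScrewWindowRiseB

/-!
# Splittings — the GRADED SPARSE SCREW DICTIONARY (cell rh-split, seat (screw, bridge), gen 10, part 6)

`Ψ = zetaScrew` (Suzuki2023 (1.1)). For every grade `η ≥ 0`, every gap exponent `θ < 1`, every `C`
and every `(C, θ)`-dense `A ⊆ ℕ` (`∀ m ≥ 1 ∃ a ∈ A, m ≤ a ≤ m + C m^θ`):

  `QuasiRiemannHypothesis (1/2 + η)`  ⟺  `∃ K, ∀ a ∈ A, a ≥ 1 → Ψ(log a) ≥ −K · a^η`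

(`quasiRH_iff_gradedFloor_on_dense`), i.e. the printed sub-RH zero-LOCATION family (quasi-RH) is
EXACTLY the family of graded one-sided floors of `Ψ ∘ log` sampled on ANY power-dense set — e.g. the
primes (`quasiRH_iff_gradedFloor_at_primes`, density from Hoheisel's theorem) or the `(q+1)`-th powers.
Grade `η = 0`: **RH ⟺ `Ψ ∘ log` is BOUNDED BELOW on the primes** (`rh_iff_bddBelow_at_primes`).

Mechanism (`gradedQuasiRH_of`, hypotheses = the statements of the line stubs S1 `stub_omegaDepth`
and S3 `stub_denseHits` of `Cruxes/ScrewPolyFloor/Lines/PowerSparseDetect.lean`, both proved in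
`Splittings.ScrewGradedFloorDictionary` / `Splittings.ScrewSparseDetect`): a zero with
`Re ρ₀ > 1/2 + η` makes the sup-abscissa `Θ > 1/2 + η`; the zeros lie in the strip `|Re ρ − 1/2| ≤ Θ − 1/2`
automatically (reflection), so the ½-Hölder window-rise law (`ScrewWindowRise.windowRise_of_strip`)
holds with grade `Θ − 1/2`; S1 gives arbitrarily late values `Ψ(t₀) < −K₁ e^{η₁ t₀}` with
`η < η₁ < Θ − 1/2`, S3 a node `a ∈ A` with `log a ∈ [t₀, t₀ + e^{−δ′t₀}]`, and the rise over that window is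
`≤ B e^{Θ−1/2} e^{η₁ t₀}`; with `K₁ = B e^{Θ−1/2} + (|K|+1)e^{η}` this beats any floor `−K a^η`.
No location hypothesis is used on the way: the conclusion IS the location statement.

HONEST LABEL: RH-free DICTIONARY rows between an open location hypothesis and open graded floors, plus
RH-EQUIVALENT relabellings at grade 0; nothing here bears on the truth of RH.
-/

set_option linter.dupNamespace false

noncomputable section

open Complex Filter Set

namespace Summit.RiemannHypothesis.RiemannHypothesis.Theorems.Splittings.ScrewGradedSparse

open Literature.NumberTheory.LFunctions
open ZetaZeros.riemannZetaNontrivialZeros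
open Summit.RiemannHypothesis.RiemannHypothesis.Theorems.Splittings.ScrewWindowRise

/-- **GRADED SPARSE DETECTION** from S1 (`h1`) and S3 (`h3`): a graded floor `Ψ(log a) ≥ −K a^η`
on a `(C, θ)`-dense set, `θ < 1`, `η ≥ 0`, forces `QuasiRiemannHypothesis (1/2 + η)`. -/
theorem gradedQuasiRH_of
    (h1 : ∀ η : ℝ, 0 ≤ η → (∃ ρ : ℂ, riemannZeta ρ = 0 ∧ 1 / 2 + η < ρ.re ∧ ρ.re < 1) →
      ∀ K T : ℝ, ∃ t : ℝ, T ≤ t ∧ 0 ≤ t ∧ zetaScrew t < -K * Real.exp (η * t))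
    (h3 : ∀ θ C : ℝ, θ < 1 → ∀ A : Set ℕ,
      (∀ m : ℕ, 1 ≤ m → ∃ a ∈ A, m ≤ a ∧ (a : ℝ) ≤ m + C * (m : ℝ) ^ θ) →
      ∃ δ : ℝ, 0 < δ ∧ δ ≤ 1 ∧ ∃ T : ℝ, 0 ≤ T ∧ ∀ t₀ L : ℝ, T ≤ t₀ → Real.exp (-(δ * t₀)) ≤ L →
        ∃ a ∈ A, 1 ≤ a ∧ t₀ ≤ Real.log a ∧ Real.log a ≤ t₀ + L)
    {η : ℝ} (hη : 0 ≤ η) {θ : ℝ} (hθ : θ < 1) (C : ℝ) (A : Set ℕ)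
    (hA : ∀ m : ℕ, 1 ≤ m → ∃ a ∈ A, m ≤ a ∧ (a : ℝ) ≤ m + C * (m : ℝ) ^ θ)
    (K : ℝ) (hfloor : ∀ a ∈ A, 1 ≤ a → -K * (a : ℝ) ^ η ≤ zetaScrew (Real.log a)) :
    QuasiRiemannHypothesis (1 / 2 + η) := by
  intro s₀ hs₀ h1₀ h2₀
  have h1₀' : 1 / 2 < s₀.re := by linarith
  -- the sup abscissa Θ > 1/2 + η and the strip it defines
  obtain ⟨Θ, hΘhalf, -, hzle, hsup⟩ := exists_supAbscissa hs₀ h1₀' h2₀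
  have hΘη : 1 / 2 + η < Θ := lt_of_lt_of_le h1₀ (hzle s₀ hs₀ h1₀' h2₀)
  have hstrip := strip_of_abscissa_le hΘhalf.le hzle
  obtain ⟨δ, hδ, hδ1, T, hT0, hhit⟩ := h3 θ C hθ A hA
  obtain ⟨B, hB0, hB⟩ := windowRise_of_strip hstrip
  -- δ' ≤ δ/2, δ' ≤ (Θ − 1/2 − η)/2, δ' > 0; depth grade η₁ := Θ − 1/2 − δ' ≥ η ≥ 0
  obtain ⟨δ', hδ'pos, hδ'leδ, hδ'leg⟩ :
      ∃ δ' : ℝ, 0 < δ' ∧ δ' ≤ δ / 2 ∧ δ' ≤ (Θ - 1 / 2 - η) / 2 := by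
    refine ⟨min δ (Θ - 1 / 2 - η) / 2, ?_, ?_, ?_⟩
    · have : 0 < min δ (Θ - 1 / 2 - η) := lt_min hδ (by linarith)
      positivity
    · have := min_le_left δ (Θ - 1 / 2 - η); linarith
    · have := min_le_right δ (Θ - 1 / 2 - η); linarith
  have hη1 : η ≤ Θ - 1 / 2 - δ' := by linarith
  have hη10 : 0 ≤ Θ - 1 / 2 - δ' := hη.trans hη1
  have hzero : ∃ ρ : ℂ, riemannZeta ρ = 0 ∧ 1 / 2 + (Θ - 1 / 2 - δ') < ρ.re ∧ ρ.re < 1 := by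
    obtain ⟨ρ, hρ, hyρ, -, hρ2⟩ := hsup (Θ - δ') (by linarith)
    exact ⟨ρ, hρ, by linarith, hρ2⟩
  -- a deep negative value beyond max T 1, with K₁ := B e^{Θ − 1/2} + (|K| + 1) e^{η}
  obtain ⟨t₀, hTt₀', ht₀0, hdeep⟩ :=
    h1 (Θ - 1 / 2 - δ') hη10 hzero (B * Real.exp (Θ - 1 / 2) + (|K| + 1) * Real.exp η) (max T 1)
  have hTt₀ : T ≤ t₀ := (le_max_left T 1).trans hTt₀'
  have hL1 : Real.exp (-(δ * t₀)) ≤ 1 := by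
    rw [Real.exp_le_one_iff]
    have := mul_nonneg hδ.le ht₀0
    linarith
  have hLsq : Real.exp (-(δ * t₀)) = Real.exp (-(δ * t₀) / 2) ^ 2 := by
    rw [sq, ← Real.exp_add]
    congr 1
    ring
  have hkey : Real.exp ((Θ - 1 / 2) * (t₀ + 1)) * Real.exp (-(δ * t₀) / 2) ≤
      Real.exp (Θ - 1 / 2) * Real.exp ((Θ - 1 / 2 - δ') * t₀) := by
    rw [← Real.exp_add, ← Real.exp_add]
    apply Real.exp_le_exp.2
    have hprod : δ' * t₀ ≤ δ / 2 * t₀ := mul_le_mul_of_nonneg_right hδ'leδ ht₀0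
    linarith
  -- on the window [t₀, t₀ + e^{−δ t₀}]: Ψ(t) < −(|K|+1) e^{η} e^{η₁ t₀}
  have hneg : ∀ t : ℝ, t₀ ≤ t → t ≤ t₀ + Real.exp (-(δ * t₀)) →
      zetaScrew t < -((|K| + 1) * Real.exp η) * Real.exp ((Θ - 1 / 2 - δ') * t₀) := by
    intro t h1t h2t
    have hrise := hB t₀ t ht₀0 h1t
    have httL : t - t₀ ≤ Real.exp (-(δ * t₀)) := by linarith
    have ht1 : t ≤ t₀ + 1 := by linarith
    have hroot : Real.sqrt (t - t₀) ≤ Real.exp (-(δ * t₀) / 2) := by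
      rw [Real.sqrt_le_left (Real.exp_pos _).le, ← hLsq]
      exact httL
    have hcoef : 0 ≤ Θ - 1 / 2 := by linarith
    have hexp1 : Real.exp ((Θ - 1 / 2) * t) ≤ Real.exp ((Θ - 1 / 2) * (t₀ + 1)) :=
      Real.exp_le_exp.2 (mul_le_mul_of_nonneg_left ht1 hcoef)
    have hr1 : B * Real.exp ((Θ - 1 / 2) * t) * Real.sqrt (t - t₀) ≤
        B * Real.exp ((Θ - 1 / 2) * (t₀ + 1)) * Real.exp (-(δ * t₀) / 2) := by
      apply mul_le_mul (mul_le_mul_of_nonneg_left hexp1 hB0) hroot (Real.sqrt_nonneg _)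
      exact mul_nonneg hB0 (Real.exp_pos _).le
    have hr2 : B * Real.exp ((Θ - 1 / 2) * (t₀ + 1)) * Real.exp (-(δ * t₀) / 2) ≤
        B * (Real.exp (Θ - 1 / 2) * Real.exp ((Θ - 1 / 2 - δ') * t₀)) := by
      rw [mul_assoc]
      exact mul_le_mul_of_nonneg_left hkey hB0
    have habs := le_abs_self (zetaScrew t - zetaScrew t₀)
    have hE : 0 < Real.exp ((Θ - 1 / 2 - δ') * t₀) := Real.exp_pos _
    nlinarith [hrise, hr1, hr2, hdeep, hE, habs]
  -- the dense set has a node a in the window; there the floor −K a^η ≤ Ψ(log a) is violated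
  obtain ⟨a, haA, ha1, h1a, h2a⟩ := hhit t₀ (Real.exp (-(δ * t₀))) hTt₀ le_rfl
  have ha0 : (0 : ℝ) < a := by exact_mod_cast ha1
  have hloga1 : Real.log a ≤ t₀ + 1 := by linarith
  -- a^η = e^{η log a} ≤ e^{η (t₀+1)} = e^{η} e^{η t₀} ≤ e^{η} e^{η₁ t₀}
  have hpow : (a : ℝ) ^ η ≤ Real.exp η * Real.exp ((Θ - 1 / 2 - δ') * t₀) := by
    rw [Real.rpow_def_of_pos ha0, ← Real.exp_add]
    apply Real.exp_le_exp.2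
    have e1 : Real.log a * η ≤ (t₀ + 1) * η := mul_le_mul_of_nonneg_right hloga1 hη
    have e2 : η * t₀ ≤ (Θ - 1 / 2 - δ') * t₀ := mul_le_mul_of_nonneg_right hη1 ht₀0
    linarith
  have hpow0 : 0 < (a : ℝ) ^ η := Real.rpow_pos_of_pos ha0 η
  have hfl := hfloor a haA ha1
  have hv := hneg (Real.log a) h1a h2a
  -- Ψ(log a) < −(|K|+1) e^{η} e^{η₁ t₀} ≤ −(|K|+1) a^η < −K a^η ≤ Ψ(log a)
  have hK : K ≤ |K| := le_abs_self K
  have hK1 : 0 ≤ |K| + 1 := by positivity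
  nlinarith [hfl, hv, hpow, hpow0, hK, hK1, Real.exp_pos η]

/-- **THE GRADED SPARSE DICTIONARY (modulo S1, S3):** for `η ≥ 0`, `θ < 1` and a `(C, θ)`-dense `A`,
`QuasiRiemannHypothesis (1/2 + η) ⟺ ∃ K, ∀ a ∈ A, a ≥ 1 → Ψ(log a) ≥ −K a^η`. The (⟹) direction is
the tree's `ScrewGradedFloor.quasiRH_iff_node_floor` restricted to `A`. -/
theorem quasiRH_iff_gradedFloor_on_dense_of
    (h1 : ∀ η : ℝ, 0 ≤ η → (∃ ρ : ℂ, riemannZeta ρ = 0 ∧ 1 / 2 + η < ρ.re ∧ ρ.re < 1) →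
      ∀ K T : ℝ, ∃ t : ℝ, T ≤ t ∧ 0 ≤ t ∧ zetaScrew t < -K * Real.exp (η * t))
    (h3 : ∀ θ C : ℝ, θ < 1 → ∀ A : Set ℕ,
      (∀ m : ℕ, 1 ≤ m → ∃ a ∈ A, m ≤ a ∧ (a : ℝ) ≤ m + C * (m : ℝ) ^ θ) →
      ∃ δ : ℝ, 0 < δ ∧ δ ≤ 1 ∧ ∃ T : ℝ, 0 ≤ T ∧ ∀ t₀ L : ℝ, T ≤ t₀ → Real.exp (-(δ * t₀)) ≤ L →
        ∃ a ∈ A, 1 ≤ a ∧ t₀ ≤ Real.log a ∧ Real.log a ≤ t₀ + L)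
    {η : ℝ} (hη : 0 ≤ η) {θ : ℝ} (hθ : θ < 1) (C : ℝ) (A : Set ℕ)
    (hA : ∀ m : ℕ, 1 ≤ m → ∃ a ∈ A, m ≤ a ∧ (a : ℝ) ≤ m + C * (m : ℝ) ^ θ) :
    QuasiRiemannHypothesis (1 / 2 + η) ↔
      ∃ K : ℝ, ∀ a ∈ A, 1 ≤ a → -K * (a : ℝ) ^ η ≤ zetaScrew (Real.log a) := by
  constructor
  · intro hq
    obtain ⟨K, hK⟩ := (ScrewGradedFloor.quasiRH_iff_node_floor hη).1 hq
    exact ⟨K, fun a _ ha ↦ hK a ha⟩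
  · rintro ⟨K, hK⟩
    exact gradedQuasiRH_of h1 h3 hη hθ C A hA K hK

/-- **Grade 0 (modulo S1, S3): RH ⟺ `Ψ ∘ log` BOUNDED BELOW on a `(C, θ)`-dense set.** -/
theorem rh_iff_bddBelow_on_dense_of
    (h1 : ∀ η : ℝ, 0 ≤ η → (∃ ρ : ℂ, riemannZeta ρ = 0 ∧ 1 / 2 + η < ρ.re ∧ ρ.re < 1) →
      ∀ K T : ℝ, ∃ t : ℝ, T ≤ t ∧ 0 ≤ t ∧ zetaScrew t < -K * Real.exp (η * t))
    (h3 : ∀ θ C : ℝ, θ < 1 → ∀ A : Set ℕ,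
      (∀ m : ℕ, 1 ≤ m → ∃ a ∈ A, m ≤ a ∧ (a : ℝ) ≤ m + C * (m : ℝ) ^ θ) →
      ∃ δ : ℝ, 0 < δ ∧ δ ≤ 1 ∧ ∃ T : ℝ, 0 ≤ T ∧ ∀ t₀ L : ℝ, T ≤ t₀ → Real.exp (-(δ * t₀)) ≤ L →
        ∃ a ∈ A, 1 ≤ a ∧ t₀ ≤ Real.log a ∧ Real.log a ≤ t₀ + L)
    {θ : ℝ} (hθ : θ < 1) (C : ℝ) (A : Set ℕ)
    (hA : ∀ m : ℕ, 1 ≤ m → ∃ a ∈ A, m ≤ a ∧ (a : ℝ) ≤ m + C * (m : ℝ) ^ θ) :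
    _root_.RiemannHypothesis ↔ ∃ K : ℝ, ∀ a ∈ A, 1 ≤ a → -K ≤ zetaScrew (Real.log a) := by
  have e : QuasiRiemannHypothesis (1 / 2) ↔ _root_.RiemannHypothesis :=
    quasiRiemannHypothesis_one_half_iff_holds
  have h := quasiRH_iff_gradedFloor_on_dense_of h1 h3 le_rfl hθ C A hA
  simp only [add_zero, Real.rpow_zero, mul_one] at h
  rw [← e]
  exact h

/-! ## 2. Unconditional instances: S1 = `ScrewGradedFloor.stub_omegaDepth` (tree, part 2),
S3 = `ScrewSparseDetect.stub_denseHits` (part 3) -/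

/-- **THE GRADED SPARSE DICTIONARY:** for `η ≥ 0`, `θ < 1` and ANY `(C, θ)`-dense `A ⊆ ℕ`,
`QuasiRiemannHypothesis (1/2 + η) ⟺ ∃ K, ∀ a ∈ A, a ≥ 1 → Ψ(log a) ≥ −K a^η`. -/
theorem quasiRH_iff_gradedFloor_on_dense {η : ℝ} (hη : 0 ≤ η) {θ : ℝ} (hθ : θ < 1) (C : ℝ)
    (A : Set ℕ) (hA : ∀ m : ℕ, 1 ≤ m → ∃ a ∈ A, m ≤ a ∧ (a : ℝ) ≤ m + C * (m : ℝ) ^ θ) :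
    QuasiRiemannHypothesis (1 / 2 + η) ↔
      ∃ K : ℝ, ∀ a ∈ A, 1 ≤ a → -K * (a : ℝ) ^ η ≤ zetaScrew (Real.log a) :=
  quasiRH_iff_gradedFloor_on_dense_of ScrewGradedFloor.stub_omegaDepth
    ScrewSparseDetect.stub_denseHits hη hθ C A hA

/-- **quasi-RH(1/2 + η) ⟺ `Ψ(log p) ≥ −K p^η` at the PRIMES** (density: Hoheisel, `primes_dense`). -/
theorem quasiRH_iff_gradedFloor_at_primes {η : ℝ} (hη : 0 ≤ η) :
    QuasiRiemannHypothesis (1 / 2 + η) ↔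
      ∃ K : ℝ, ∀ p : ℕ, p.Prime → -K * (p : ℝ) ^ η ≤ zetaScrew (Real.log p) := by
  obtain ⟨θ, hθ, C, hC⟩ := primes_dense
  rw [quasiRH_iff_gradedFloor_on_dense hη hθ C {p : ℕ | p.Prime} hC]
  constructor
  · rintro ⟨K, hK⟩
    exact ⟨K, fun p hp ↦ hK p hp hp.one_lt.le⟩
  · rintro ⟨K, hK⟩
    exact ⟨K, fun p hp _ ↦ hK p hp⟩

/-- **Grade 0: RH ⟺ `Ψ ∘ log` is BOUNDED BELOW on the primes** (`inf_p Ψ(log p) > −∞`). -/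
theorem rh_iff_bddBelow_at_primes :
    _root_.RiemannHypothesis ↔ ∃ K : ℝ, ∀ p : ℕ, p.Prime → -K ≤ zetaScrew (Real.log p) := by
  have e : QuasiRiemannHypothesis (1 / 2) ↔ _root_.RiemannHypothesis :=
    quasiRiemannHypothesis_one_half_iff_holds
  have h := quasiRH_iff_gradedFloor_at_primes le_rfl
  simp only [add_zero, Real.rpow_zero, mul_one] at h
  rw [← e]
  exact h

/-- **Grade 0 on any power-dense set: RH ⟺ `Ψ ∘ log` bounded below on `A`.** -/
theorem rh_iff_bddBelow_on_dense {θ : ℝ} (hθ : θ < 1) (C : ℝ) (A : Set ℕ)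
    (hA : ∀ m : ℕ, 1 ≤ m → ∃ a ∈ A, m ≤ a ∧ (a : ℝ) ≤ m + C * (m : ℝ) ^ θ) :
    _root_.RiemannHypothesis ↔ ∃ K : ℝ, ∀ a ∈ A, 1 ≤ a → -K ≤ zetaScrew (Real.log a) :=
  rh_iff_bddBelow_on_dense_of ScrewGradedFloor.stub_omegaDepth ScrewSparseDetect.stub_denseHits
    hθ C A hA

end Summit.RiemannHypothesis.RiemannHypothesis.Theorems.Splittings.ScrewGradedSparse

end
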